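import Mathlib
import HarnessLib
import Summits.RiemannHypothesis.RiemannHypothesis.Theses.WeilWindowFlow
import Literature.NumberTheory.LFunctions.WeilExplicit
import Literature.NumberTheory.LFunctions.WeilWindowSuzukiContinuityProofs

/-!
# Triage scratch W2 — crux-triage r1-3, card `archimedean-leakage-rung`

(1) The card's corollary target `StrictArchimedeanRange` is EQUIVALENT to the route's existing
support item `StrictArchimedeanBottom` (stmt-RiemannHypothesis-1042) by antitonicity of `ε` alone.
(2) Child 1 (`ArchimedeanDiniLeakage`) already implies `StrictArchimedeanBottom` is NOT shown here
(it needs the Grönwall fence of the standing Disproof.lean, `mul_exp_le_of_diniBoundAt`, plus the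
coercive anchor); we only record the cheap half: given strictness on the range and an ABSOLUTE
(Lipschitz-type) lower-right Dini bound on prime-free ranges, child 1 follows with
`K = L / ε(log 2 / 2)` — i.e. child 1 = item 1042 ∧ (item 1039 restricted to `A ≤ log 2 / 2`,
lower-Dini form), two EXISTING items' sub-cases.
-/

noncomputable section

open Set Filter MeasureTheory
open scoped Real Topology

namespace TriageR13

open Literature.NumberTheory.LFunctions
open Summit.RiemannHypothesis.RiemannHypothesis.Theses.WeilWindowFlow

/-- Antitonicity of the window bottom (same 3-line proof as `SketchIdeator2.weilGroundEnergy_antitone`). -/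
theorem eps_antitone {a b : ℝ} (hb : 0 < b) (hba : b ≤ a) :
    weilGroundEnergy a ≤ weilGroundEnergy b := by
  refine le_weilGroundEnergy_of_forall hb fun h hh hsupp hnorm ↦ ?_
  exact weilGroundEnergy_le_re_weilQuadratic hh
    (hsupp.trans (Icc_subset_Icc (neg_le_neg hba) hba)) hnorm

/-- Card C2, verbatim from SketchIdeator2. -/
def StrictArchimedeanRange : Prop :=
  ∀ a : ℝ, 0 < a → a ≤ Real.log 2 / 2 → 0 < weilGroundEnergy a

/-- C2 ⟺ route item 1042 (`StrictArchimedeanBottom : 0 < ε (log 2 / 2)`). -/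
theorem strictArchimedeanRange_iff : StrictArchimedeanRange ↔ StrictArchimedeanBottom := by
  have hlog : (0 : ℝ) < Real.log 2 / 2 := div_pos (Real.log_pos one_lt_two) two_pos
  constructor
  · exact fun h ↦ h _ hlog le_rfl
  · intro h a ha hle
    exact h.trans_le (eps_antitone ha hle)

/-- Child 1 of the card, verbatim. -/
def ArchimedeanDiniLeakage : Prop :=
  ∀ b₀ A : ℝ, 0 < b₀ → b₀ ≤ A → A ≤ Real.log 2 / 2 → ∃ K : ℝ, 0 ≤ K ∧ ∀ a : ℝ, b₀ ≤ a → a ≤ A →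
    ∀ η δ : ℝ, 0 < η → 0 < δ → ∃ h : ℝ, 0 < h ∧ h < δ ∧
      weilGroundEnergy a - weilGroundEnergy (a + h) ≤ h * (K * weilGroundEnergy a + η)

/-- The prime-free sub-case of crux `WindowLipschitz` (stmt-1039) in the same lower-right Dini shape. -/
def ArchimedeanLowerRightLipschitz : Prop :=
  ∀ b₀ A : ℝ, 0 < b₀ → b₀ ≤ A → A ≤ Real.log 2 / 2 → ∃ L : ℝ, 0 ≤ L ∧ ∀ a : ℝ, b₀ ≤ a → a ≤ A →
    ∀ η δ : ℝ, 0 < η → 0 < δ → ∃ h : ℝ, 0 < h ∧ h < δ ∧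
      weilGroundEnergy a - weilGroundEnergy (a + h) ≤ h * (L + η)

/-- Child 1 ⟸ item 1042 ∧ prime-free lower-right Lipschitz: `K := L / ε(log 2 / 2)`. -/
theorem archimedeanDiniLeakage_of (h42 : StrictArchimedeanBottom)
    (hL : ArchimedeanLowerRightLipschitz) : ArchimedeanDiniLeakage := by
  intro b₀ A hb hbA hA
  obtain ⟨L, hL0, hL⟩ := hL b₀ A hb hbA hA
  set m := weilGroundEnergy (Real.log 2 / 2) with hm
  have hm0 : 0 < m := h42
  refine ⟨L / m, div_nonneg hL0 hm0.le, fun a hba haA η δ hη hδ ↦ ?_⟩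
  obtain ⟨h, hh, hhδ, hmain⟩ := hL a hba haA η δ hη hδ
  refine ⟨h, hh, hhδ, hmain.trans ?_⟩
  have ha : 0 < a := hb.trans_le hba
  have hεa : m ≤ weilGroundEnergy a := eps_antitone ha (haA.trans hA)
  have : L ≤ L / m * weilGroundEnergy a := by
    rw [div_mul_eq_mul_div, le_div_iff₀ hm0]
    exact mul_le_mul_of_nonneg_left hεa hL0
  nlinarith

end TriageR13

end
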